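import Literature.MathematicalPhysics.QuantumLattice.TorusWilsonLinkTranslations
import Literature.MathematicalPhysics.QuantumLattice.GaugeGroups
import Literature.MathematicalPhysics.QuantumFieldTheory.Sweep1AreaLawProofs
import HarnessLib

/-!
# Resampling one link of a product Haar measure, and the one-link oscillation of the Wilson weight

HONEST FRAMING (cell `pub-ymgap`, seat qcd-lit g19, `bears_on: Q1`).  Two volume-independent
measure-theoretic facts about the torus Wilson theory `e^{-β S_W(U)} ∏_e dU_e`, both standard
(Seiler LNP 159 Ch. 1–2: the a priori measure is a product of Haar measures and the Wilson action is a
sum of bounded plaquette terms each reading four links), proved here as theorems; nothing about limits.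
They are the gauge-field input of the cell's small-`β` version of Salmhofer–Seiler's Schwinger–Dyson
bound: at `β = 0` "the gauge integration can be done separately on each link" [SalmhoferSeiler1991,
§2 p. 400]; at `β > 0` one still integrates ONE link at a time, at the cost of a factor `e^{±β c}`
with `c` independent of the volume.

* **`measurePreserving_update`** — for a probability measure `μ` and the product `μ^{⊗ι}`, the map
  `(x, a) ↦ x[i ← a]` pushes `μ^{⊗ι} ⊗ μ` forward to `μ^{⊗ι}` ("resampling the coordinate `i`");
  hence **`integral_eq_integral_integral_update`**: `∫ f dμ^{⊗ι} = ∫ (∫ f(x[i ← a]) dμ(a)) dμ^{⊗ι}(x)`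
  for every integrable `f` — the one-link conditional Haar integral.
* **`abs_wilsonAction_update_sub_update_le`** — changing ONE link variable moves the Wilson action
  of `U(N)` (defining representation) by at most `linkOsc d N = 4(d+1)·#{planes}·2N`, uniformly in the
  side `L` of the torus (the tree's `abs_wilsonAction_sub_wilsonAction_le` with `|Re tr U| ≤ N`);
  hence the one-link comparison of Boltzmann factors **`exp_wilson_update_le`**,
  **`abs_exp_wilson_update_sub_le`**: `e^{-βS(U[e←g])} ≤ e^{βc} e^{-βS(U[e←h])}` and
  `|e^{-βS(U[e←g])} - e^{-βS(U[e←h])}| ≤ (e^{βc} - 1) e^{-βS(U[e←h])}` for `β ≥ 0`.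

References: E. Seiler, LNP 159 (1982), Ch. 1–2 [SeilerLNP1982]; M. Salmhofer, E. Seiler, CMP 139 (1991)
395, §2 (2.2), (2.12), p. 400 [SalmhoferSeiler1991].
-/

noncomputable section

open MeasureTheory

namespace Literature.MathematicalPhysics.QuantumLattice

/-! ### Resampling one coordinate of a product probability measure -/

section Resampling

variable {ι : Type*} [Fintype ι] [DecidableEq ι] {α : Type*} [MeasurableSpace α]
  (μ : Measure α) [IsProbabilityMeasure μ]

omit [Fintype ι] [MeasurableSpace α] in
/-- The preimage of a box under `(x, a) ↦ x[i ← a]`. [cite: SalmhoferSeiler1991, §2 (2.2) and (2.12)] -/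
theorem preimage_update_univ_pi (i : ι) (s : ι → Set α) :
    (fun p : (ι → α) × α => Function.update p.1 i p.2) ⁻¹' Set.pi Set.univ s =
      Set.pi Set.univ (Function.update s i Set.univ) ×ˢ s i := by
  ext ⟨x, a⟩
  simp only [Set.mem_preimage, Set.mem_univ_pi, Set.mem_prod]
  constructor
  · intro h
    refine ⟨fun j => ?_, by simpa using h i⟩
    by_cases hj : j = i
    · subst hj; simp
    · rw [Function.update_of_ne hj]; simpa [Function.update_of_ne hj] using h j
  · rintro ⟨h1, h2⟩ j
    by_cases hj : j = i
    · subst hj; simpa using h2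
    · rw [Function.update_of_ne hj]; simpa [Function.update_of_ne hj] using h1 j

/-- **Resampling one coordinate**: `(x, a) ↦ x[i ← a]` pushes `μ^{⊗ι} ⊗ μ` forward to `μ^{⊗ι}` (`μ` a
probability measure) — the product structure of the a priori measure `∏_e dU_e`. [cite: SalmhoferSeiler1991, §2 (2.2) and (2.12)] -/
theorem measurePreserving_update (i : ι) :
    MeasurePreserving (fun p : (ι → α) × α => Function.update p.1 i p.2)
      ((Measure.pi fun _ : ι => μ).prod μ) (Measure.pi fun _ : ι => μ) := by
  refine ⟨measurable_update', (Measure.pi_eq fun s hs => ?_).symm⟩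
  rw [Measure.map_apply measurable_update' (MeasurableSet.univ_pi hs), preimage_update_univ_pi,
    Measure.prod_prod, Measure.pi_pi, ← Finset.prod_erase_mul Finset.univ (fun j => μ (s j)) (Finset.mem_univ i),
    ← Finset.prod_erase_mul Finset.univ _ (Finset.mem_univ i), Function.update_self, measure_univ, mul_one]
  congr 1
  exact Finset.prod_congr rfl fun j hj => by rw [Function.update_of_ne (Finset.ne_of_mem_erase hj)]

/-- Integrability is preserved under resampling. [cite: SalmhoferSeiler1991, §2 (2.12)] -/
theorem integrable_comp_update {E : Type*} [NormedAddCommGroup E] (i : ι) {f : (ι → α) → E}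
    (hf : Integrable f (Measure.pi fun _ : ι => μ)) :
    Integrable (fun p : (ι → α) × α => f (Function.update p.1 i p.2)) ((Measure.pi fun _ : ι => μ).prod μ) :=
  ((measurePreserving_update μ i).integrable_comp hf.aestronglyMeasurable).mpr hf

/-- **The resampling identity**: `∫ f(x[i ← a]) d(μ^{⊗ι} ⊗ μ)(x, a) = ∫ f dμ^{⊗ι}`. [cite: SalmhoferSeiler1991, §2 (2.12) and p. 400] -/
theorem integral_update_prod_eq {E : Type*} [NormedAddCommGroup E] [NormedSpace ℝ E] (i : ι) {f : (ι → α) → E}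
    (hf : Integrable f (Measure.pi fun _ : ι => μ)) :
    ∫ p, f (Function.update p.1 i p.2) ∂((Measure.pi fun _ : ι => μ).prod μ) = ∫ x, f x ∂(Measure.pi fun _ : ι => μ) := by
  have hΨ := measurePreserving_update μ i
  have hfm : AEStronglyMeasurable f (Measure.map (fun p : (ι → α) × α => Function.update p.1 i p.2)
      ((Measure.pi fun _ : ι => μ).prod μ)) := by
    rw [hΨ.map_eq]; exact hf.aestronglyMeasurable
  rw [← integral_map hΨ.measurable.aemeasurable hfm, hΨ.map_eq]

/-- **The one-coordinate conditional integral**: `∫ f dμ^{⊗ι} = ∫ (∫ f(x[i ← a]) dμ(a)) dμ^{⊗ι}(x)` for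
every integrable `f` — "the integration over one link variable can be done first". [cite: SalmhoferSeiler1991, §2 p. 400] -/
theorem integral_eq_integral_integral_update {E : Type*} [NormedAddCommGroup E] [NormedSpace ℝ E] (i : ι)
    {f : (ι → α) → E} (hf : Integrable f (Measure.pi fun _ : ι => μ)) :
    ∫ x, f x ∂(Measure.pi fun _ : ι => μ) =
      ∫ x, (∫ a, f (Function.update x i a) ∂μ) ∂(Measure.pi fun _ : ι => μ) := by
  rw [← integral_update_prod_eq μ i hf, integral_prod _ (integrable_comp_update μ i hf)]

omit [Fintype ι] [MeasurableSpace α] [IsProbabilityMeasure μ] in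
/-- Updating twice at the same coordinate keeps the last value. [cite: SalmhoferSeiler1991, §2 (2.12)] -/
theorem update_update_same (x : ι → α) (i : ι) (a b : α) :
    Function.update (Function.update x i a) i b = Function.update x i b :=
  Function.update_idem _ _ _

end Resampling

/-! ### The one-link oscillation of the Wilson action and of the Boltzmann factor -/

section Oscillation

open Literature.MathematicalPhysics.QuantumFieldTheory (Site Edge Plaquette GaugeConfig wilsonAction)

variable {d L N : ℕ} [NeZero L]

/-- The volume-independent one-link oscillation constant `c = 2(d+1)·#{planes}·(N+N)` of the `U(N)`
Wilson action. [cite: SeilerLNP1982, Ch. 2] -/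
def linkOsc (d N : ℕ) : ℝ :=
  2 * (((d + 1) * Fintype.card {q : Fin d × Fin d // q.1 < q.2} : ℕ) : ℝ) * ((N : ℝ) + N) * 1

omit [NeZero L] in
/-- `0 ≤ c`. [cite: SeilerLNP1982, Ch. 2] -/
theorem linkOsc_nonneg (d N : ℕ) : 0 ≤ linkOsc d N := by
  unfold linkOsc; positivity

/-- **Changing one link moves the `U(N)` Wilson action by at most `c`, uniformly in the volume** (the
action is a sum of bounded plaquette terms, each reading four links). [cite: SeilerLNP1982, Ch. 2] -/
theorem abs_wilsonAction_update_sub_update_le (U : GaugeConfig d L (Matrix.unitaryGroup (Fin N) ℂ)) (e : Edge d L)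
    (g h : Matrix.unitaryGroup (Fin N) ℂ) :
    |wilsonAction (unitaryFundamentalRep (Fin N) ℂ) (Function.update U e g) -
        wilsonAction (unitaryFundamentalRep (Fin N) ℂ) (Function.update U e h)| ≤ linkOsc d N := by
  have h1 := abs_wilsonAction_sub_wilsonAction_le (d := d) (L := L) (unitaryFundamentalRep (Fin N) ℂ) (M := (N : ℝ))
    (fun g => QuantumFieldTheory.abs_re_trace_le_of_mem_unitaryGroup g.2) {e} (Function.update U e g) (Function.update U e h)
    (fun e' he' => by
      rw [Finset.mem_singleton] at he'
      rw [Function.update_of_ne he', Function.update_of_ne he'])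
  rwa [Finset.card_singleton, Nat.cast_one] at h1

omit [NeZero L] in
/-- `e^{-βa} ≤ e^{βc} e^{-βb}` when `|a - b| ≤ c`, `β ≥ 0` (comparison of Boltzmann factors). [cite: SeilerLNP1982, Ch. 2] -/
theorem exp_neg_mul_le_of_abs_sub_le {a b c β : ℝ} (hβ : 0 ≤ β) (h : |a - b| ≤ c) :
    Real.exp (-β * a) ≤ Real.exp (β * c) * Real.exp (-β * b) := by
  rw [← Real.exp_add]
  refine Real.exp_le_exp.mpr ?_
  have := (abs_sub_le_iff.mp h).2
  nlinarith

omit [NeZero L] in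
/-- `|e^{-βa} - e^{-βb}| ≤ (e^{βc} - 1) e^{-βb}` when `|a - b| ≤ c`, `β ≥ 0` (oscillation of Boltzmann factors). [cite: SeilerLNP1982, Ch. 2] -/
theorem abs_exp_neg_mul_sub_le_of_abs_sub_le {a b c β : ℝ} (hβ : 0 ≤ β) (h : |a - b| ≤ c) :
    |Real.exp (-β * a) - Real.exp (-β * b)| ≤ (Real.exp (β * c) - 1) * Real.exp (-β * b) := by
  have hb : 0 < Real.exp (-β * b) := Real.exp_pos _
  have hup : Real.exp (-β * a) ≤ Real.exp (β * c) * Real.exp (-β * b) := exp_neg_mul_le_of_abs_sub_le hβ h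
  have hdown : Real.exp (-β * b) ≤ Real.exp (β * c) * Real.exp (-β * a) :=
    exp_neg_mul_le_of_abs_sub_le hβ (by rwa [abs_sub_comm] at h)
  have hc1 : 1 ≤ Real.exp (β * c) := Real.one_le_exp (mul_nonneg hβ ((abs_nonneg _).trans h))
  rw [abs_sub_le_iff]
  constructor
  · linarith
  · -- `e^{-βb} - e^{-βa} ≤ (e^{βc}-1) e^{-βb}` since `e^{-βa} ≥ e^{-βc} e^{-βb} ≥ (2 - e^{βc}) e^{-βb}`
    have ha : 0 < Real.exp (-β * a) := Real.exp_pos _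
    nlinarith [mul_pos ha hb, sq_nonneg (Real.exp (β * c) - 1)]

/-- **One-link comparison of Wilson Boltzmann factors**: `e^{-βS(U[e←g])} ≤ e^{βc} e^{-βS(U[e←h])}`, `β ≥ 0`. [cite: SeilerLNP1982, Ch. 2] -/
theorem exp_wilson_update_le {β : ℝ} (hβ : 0 ≤ β) (U : GaugeConfig d L (Matrix.unitaryGroup (Fin N) ℂ)) (e : Edge d L)
    (g h : Matrix.unitaryGroup (Fin N) ℂ) :
    Real.exp (-β * wilsonAction (unitaryFundamentalRep (Fin N) ℂ) (Function.update U e g)) ≤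
      Real.exp (β * linkOsc d N) * Real.exp (-β * wilsonAction (unitaryFundamentalRep (Fin N) ℂ) (Function.update U e h)) :=
  exp_neg_mul_le_of_abs_sub_le hβ (abs_wilsonAction_update_sub_update_le U e g h)

/-- **One-link oscillation of the Wilson Boltzmann factor**:
`|e^{-βS(U[e←g])} - e^{-βS(U[e←h])}| ≤ (e^{βc} - 1) e^{-βS(U[e←h])}`, `β ≥ 0`, `c` volume-independent. [cite: SeilerLNP1982, Ch. 2] -/
theorem abs_exp_wilson_update_sub_le {β : ℝ} (hβ : 0 ≤ β) (U : GaugeConfig d L (Matrix.unitaryGroup (Fin N) ℂ))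
    (e : Edge d L) (g h : Matrix.unitaryGroup (Fin N) ℂ) :
    |Real.exp (-β * wilsonAction (unitaryFundamentalRep (Fin N) ℂ) (Function.update U e g)) -
        Real.exp (-β * wilsonAction (unitaryFundamentalRep (Fin N) ℂ) (Function.update U e h))| ≤
      (Real.exp (β * linkOsc d N) - 1) *
        Real.exp (-β * wilsonAction (unitaryFundamentalRep (Fin N) ℂ) (Function.update U e h)) :=
  abs_exp_neg_mul_sub_le_of_abs_sub_le hβ (abs_wilsonAction_update_sub_update_le U e g h)

/-- The Wilson Boltzmann factor is a continuous function of the `U(N)` gauge field. [cite: SalmhoferSeiler1991, §2 (2.2), (2.12)] -/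
theorem continuous_exp_wilsonAction (β : ℝ) :
    Continuous fun U : GaugeConfig d L (Matrix.unitaryGroup (Fin N) ℂ) =>
      Real.exp (-β * wilsonAction (unitaryFundamentalRep (Fin N) ℂ) U) := by
  refine Real.continuous_exp.comp (Continuous.const_mul ?_ _)
  unfold wilsonAction
  refine continuous_finsetSum _ fun p _ => ?_
  have h1 : Continuous fun U : GaugeConfig d L (Matrix.unitaryGroup (Fin N) ℂ) =>
      Literature.MathematicalPhysics.QuantumFieldTheory.plaquetteHolonomy U p.1 p.2.1.1 p.2.1.2 := by
    unfold Literature.MathematicalPhysics.QuantumFieldTheory.plaquetteHolonomy; fun_prop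
  exact continuous_const.sub (Complex.continuous_re.comp ((continuous_subtype_val.comp h1).matrix_trace))

end Oscillation

end Literature.MathematicalPhysics.QuantumLattice
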